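import Summits.BirchSwinnertonDyer.BirchSwinnertonDyer.Theorems.ResidualThetaTransportAtTwoResidualSignedLambdaLowerCMAtTwoAtTwoLocalKummer
import Summits.BirchSwinnertonDyer.BirchSwinnertonDyer.Theorems.ThetaPartnerAtTwoSignedKatoUpToAtTwoPointsFunctional
import Literature.NumberTheory.EllipticCurves.Sha
import HarnessLib

/-!
# T1 (AtTwo package), part 4: (PERF₂) — EVERY character of `D₂ = H¹(ℚ_{∞,v}, A_ρ)` is the level-value character of a `ℤ₂`-valued functional on
# the tower tuples `E(ℚ_{∞,v})ⁿ`; hence any value-pinned `c₂ : 𝔉₂ →+ CharacterModule D₂` is SURJECTIVE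

Route `ResidualThetaTransportAtTwo` (RTT), crux RSL_g `ResidualSignedLambdaLowerCMAtTwo` (stmt-BirchSwinnertonDyer-22608), line «onepair», GLUE-SPEC-g18 §1
T1 (c) `(PERF₂) Function.Surjective π₂.c₂`; seat `prover-bsd-wall-tp2-p2x-w2` g20 (`--supports`, closes nothing). THEOREMS ONLY (no definition, no named
fact, no instance, no `sorry`). BSD is not proved by any of this; RSL_g (22608) stays OPEN.

* §1 `oneCocycleClass_eq_zero_of_torsionWitness` — a local class whose Kummer tuple lies in `E(ℚ_{∞,v}) + ι(E[2^∞])` coordinatewise is ZERO (it is the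
  coboundary of `Θ⁻¹` of the torsion parts; `pointsMapOfEmb_injective`, `hΘ`).
* §2 **`exists_functional_of_character`** — for EVERY `χ : CharacterModule D₂` there is `t : (Fin n → E(ℚ_{∞,v})) →+ ℤ₂` with
  `χ y = (t(2^k Q) mod 2^k) • 2^{-k}` on every local Θ-Kummer datum `(ψ, Q, k)` of `y` — the tuple/local twin of TP2's
  `SignedKatoOffTwo.KummerPoint.exists_functional_of_kummerCharacter` (descend `χ` to witness tuples, kill `E(ℚ_{∞,v}) + ι(torsion)` by §1, extend by the
  injectivity of `ℚ/ℤ`, read compatible residues on chosen roots, `exists_padicInt_toZModPow_eq`). No habitat hypothesis beyond `hΘ`.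
* §3 **`surjective_of_valuePin`** — on the habitat (every class HAS a datum, part 1 `exists_localKummerData`) any `c₂` carrying the VALUE PIN
  (`AtTwoPins.hc₂`) is surjective: (PERF₂).

References: [Kobayashi2003] §2 p. 4, (8.23) (p. 18); [GreenbergLNM1716] §2; [SilvermanAEC2009] VIII §2, X §4; [MilneADT2006] I §6.
-/

set_option autoImplicit false
-- the Theorems namespace of this sub repeats the summit name by design (D-0017 nested layout)
set_option linter.dupNamespace false

noncomputable section

open scoped Classical

namespace Summit.BirchSwinnertonDyer.BirchSwinnertonDyer.Theorems.ThetaTransport.AtTwoPackage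

open CategoryTheory Field NumberField IsDedekindDomain WeierstrassCurve
  Literature.NumberTheory.EllipticCurves Literature.NumberTheory.GaloisRepresentations
  Literature.NumberTheory.EllipticCurves.GreenbergSelmer Literature.NumberTheory.EllipticCurves.CyclotomicLayer
  Literature.NumberTheory.EllipticCurves.Kobayashi2003 Literature.NumberTheory.EllipticCurves.Sprung2012
  Summit.BirchSwinnertonDyer.BirchSwinnertonDyer.Theorems.OnePair
  Summit.BirchSwinnertonDyer.BirchSwinnertonDyer.Theorems.SignedKatoOffTwo.KummerPoint

variable (S : Set (PadicAlgCl 2)) (ρ : FramedGaloisRep ℚ ↥(padicCoeffIntegers S) 2)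
  (W : WeierstrassCurve ℚ) [W.IsElliptic] {r : ℕ} (Θ : Cofree ρ ↥(padicCoeffField S) ≃+ (Fin r → ↥(W.geomPrimaryTorsion 2)))
  (κ : ZpExtension ℚ 2) (v : HeightOneSpectrum (𝓞 ℚ))
  (hΘ : ∀ (δ : absoluteGaloisGroup (v.adicCompletion ℚ)) (m : Cofree ρ ↥(padicCoeffField S)) (i : Fin r),
    Θ (resGalOfEmb (closureEmb (K := ℚ) (v.adicCompletion ℚ)) δ • m) i =
      resGalOfEmb (closureEmb (K := ℚ) (v.adicCompletion ℚ)) δ • Θ m i)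

/-! ## §1 Classes with a torsion-translated rational witness vanish -/

omit [W.IsElliptic] in
include hΘ in
/-- **A local class whose Kummer tuple is `e + ι(t)`, `e ∈ E(ℚ_{∞,v})ⁿ`, `t ∈ (E[2^∞])ⁿ`, is ZERO**: its cocycle is `τ ↦ τ•a − a`, `a = Θ⁻¹ t`
(`pointsMapOfEmb_injective`, `hΘ`). [cite: SilvermanAEC2009, VIII §2] [cite: MilneADT2006, I §6] -/
theorem oneCocycleClass_eq_zero_of_torsionWitness
    (ψ : contOneCocycles (subgroupRep (localRepOf (cofreeGaloisModule S ρ) v) (kerGroup κ v)))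
    (Q : Fin r → localPoints W (v.adicCompletion ℚ))
    (hK : ∀ (τ : ↥(kerGroup κ v)) (i : Fin r), pointsMapOfEmb W (closureEmb (K := ℚ) (v.adicCompletion ℚ))
      ((Θ (ψ.1 τ) i : ↥(W.geomPrimaryTorsion 2)) : W.geomPoints) = (τ : absoluteGaloisGroup (v.adicCompletion ℚ)) • Q i - Q i)
    (e : Fin r → localPoints W (v.adicCompletion ℚ)) (he : ∀ i, e i ∈ localTowerPointsOfEmb κ (closureEmb (K := ℚ) (v.adicCompletion ℚ)) W)
    (t : Fin r → ↥(W.geomPrimaryTorsion 2))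
    (hQ : ∀ i, Q i = e i + pointsMapOfEmb W (closureEmb (K := ℚ) (v.adicCompletion ℚ)) ((t i : ↥(W.geomPrimaryTorsion 2)) : W.geomPoints)) :
    oneCocycleClass _ ψ = 0 := by
  rw [oneCocycleClass_eq_zero_iff]
  refine ⟨Θ.symm t, fun τ ↦ ?_⟩
  -- compare through `Θ` and `ι`, coordinatewise
  apply Θ.injective
  funext i
  apply Subtype.ext
  apply pointsMapOfEmb_injective W (closureEmb (K := ℚ) (v.adicCompletion ℚ))
  have hfix : (τ : absoluteGaloisGroup (v.adicCompletion ℚ)) • e i = e i := (mem_localTowerPointsOfEmb_iff κ _ W (e i)).1 (he i) τ τ.2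
  change pointsMapOfEmb W _ ((Θ (ψ.1 τ) i : ↥(W.geomPrimaryTorsion 2)) : W.geomPoints) =
    pointsMapOfEmb W _ ((Θ (resGalOfEmb (closureEmb (K := ℚ) (v.adicCompletion ℚ)) (τ : absoluteGaloisGroup (v.adicCompletion ℚ)) • Θ.symm t - Θ.symm t) i :
      ↥(W.geomPrimaryTorsion 2)) : W.geomPoints)
  rw [hK τ i, hQ i, map_sub, Pi.sub_apply, AddSubgroupClass.coe_sub, map_sub, hΘ, AddEquiv.apply_symm_apply, primaryComponent.coe_smul,
    pointsMapOfEmb_smul, smul_add, hfix]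
  abel

/-! ## §2 Every character of `D₂` is a Kummer-value character -/

-- the witness bookkeeping over tuples (as in TP2 `exists_functional_of_kummerCharacter`) is long
set_option maxHeartbeats 1600000 in
include hΘ in
/-- **Every character of `D₂ = H¹(ℚ_{∞,v}, A_ρ)` is the level-value character of a `ℤ₂`-valued functional on the tower tuples** (tuple/local twin of TP2
`exists_functional_of_kummerCharacter`): for `χ : CharacterModule D₂` there is `t : (Fin n → E(ℚ_{∞,v})) →+ ℤ₂` with `χ y = (t(2^kQ) mod 2^k) • 2^{-k}` for EVERY
local Θ-Kummer datum `(ψ, Q, k)` of `y`. Construction: `χ` descends to the witness tuples `Q` (two witnessed classes whose tuples differ by an element of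
`N = (E(ℚ_{∞,v}) + ι E[2^∞])ⁿ` have the same `χ`, §1), extends by `0` on `N` and then to all tuples (`ℚ/ℤ` injective); on `2^k`-th roots of tower tuples it
takes values in `(ℤ/2^k) • 2^{-k}`, compatible in `k` (`p • root_{k+1}` is a `k`-th root), whence `t` (`exists_padicInt_toZModPow_eq`).
[cite: Kobayashi2003, §2 (p. 4)] [cite: GreenbergLNM1716, §2] [cite: SilvermanAEC2009, VIII §2, X §4] -/
theorem exists_functional_of_character (χ : CharacterModule (Dloc S κ ρ v)) :
    ∃ t : (Fin r → ↥(localTowerPointsOfEmb κ (closureEmb (K := ℚ) (v.adicCompletion ℚ)) W)) →+ ℤ_[2],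
      ∀ (y : Dloc S κ ρ v) (ψ : contOneCocycles (subgroupRep (localRepOf (cofreeGaloisModule S ρ) v) (kerGroup κ v)))
        (Q : Fin r → localPoints W (v.adicCompletion ℚ)) (k : ℕ)
        (hQ : ∀ i, (2 ^ k) • Q i ∈ localTowerPointsOfEmb κ (closureEmb (K := ℚ) (v.adicCompletion ℚ)) W),
        oneCocycleClass (subgroupRep (localRepOf (cofreeGaloisModule S ρ) v) (kerGroup κ v)) ψ = y →
        (∀ (τ : ↥(kerGroup κ v)) (i : Fin r), pointsMapOfEmb W (closureEmb (K := ℚ) (v.adicCompletion ℚ))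
          ((Θ (ψ.1 τ) i : ↥(W.geomPrimaryTorsion 2)) : W.geomPoints) = (τ : absoluteGaloisGroup (v.adicCompletion ℚ)) • Q i - Q i) →
        χ y = (PadicInt.toZModPow k (t (fun i => ⟨(2 ^ k) • Q i, hQ i⟩))).val • ((((2 : ℚ) ^ k)⁻¹ : ℚ) : AddCircle (1 : ℚ)) := by
  -- notation
  set T : AddSubgroup (localPoints W (v.adicCompletion ℚ)) := localTowerPointsOfEmb κ (closureEmb (K := ℚ) (v.adicCompletion ℚ)) W with hT
  set Tι : AddSubgroup (localPoints W (v.adicCompletion ℚ)) := (W.geomPrimaryTorsion 2).map (pointsMapOfEmb W (closureEmb (K := ℚ) (v.adicCompletion ℚ))) with hTι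
  set N₁ : AddSubgroup (localPoints W (v.adicCompletion ℚ)) := T ⊔ Tι with hN₁
  set N : AddSubgroup (Fin r → localPoints W (v.adicCompletion ℚ)) := AddSubgroup.pi Set.univ (fun _ ↦ N₁) with hN
  have hmemN : ∀ {Q : Fin r → localPoints W (v.adicCompletion ℚ)}, Q ∈ N ↔ ∀ i, Q i ∈ N₁ := fun {Q} ↦ by
    rw [hN, AddSubgroup.mem_pi]; exact ⟨fun h i ↦ h i (Set.mem_univ i), fun h i _ ↦ h i⟩
  -- the witness predicate
  let IsW : contOneCocycles (subgroupRep (localRepOf (cofreeGaloisModule S ρ) v) (kerGroup κ v)) →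
      (Fin r → localPoints W (v.adicCompletion ℚ)) → Prop := fun ψ Q ↦
    ∀ (τ : ↥(kerGroup κ v)) (i : Fin r), pointsMapOfEmb W (closureEmb (K := ℚ) (v.adicCompletion ℚ))
      ((Θ (ψ.1 τ) i : ↥(W.geomPrimaryTorsion 2)) : W.geomPoints) = (τ : absoluteGaloisGroup (v.adicCompletion ℚ)) • Q i - Q i
  have isW_add : ∀ {ψ ψ' Q Q'}, IsW ψ Q → IsW ψ' Q' → IsW (ψ + ψ') (Q + Q') := fun {ψ ψ' Q Q'} h h' τ i ↦ by
    have e : ((ψ + ψ').1 τ : Cofree ρ ↥(padicCoeffField S)) = ψ.1 τ + ψ'.1 τ := rfl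
    change pointsMapOfEmb W _ ((Θ ((ψ + ψ').1 τ) i : ↥(W.geomPrimaryTorsion 2)) : W.geomPoints) = _
    rw [e, map_add, Pi.add_apply, AddMemClass.coe_add, map_add, h τ i, h' τ i, Pi.add_apply, smul_add]
    abel
  have isW_neg : ∀ {ψ Q}, IsW ψ Q → IsW (-ψ) (-Q) := fun {ψ Q} h τ i ↦ by
    have e : ((-ψ).1 τ : Cofree ρ ↥(padicCoeffField S)) = -ψ.1 τ := rfl
    change pointsMapOfEmb W _ ((Θ ((-ψ).1 τ) i : ↥(W.geomPrimaryTorsion 2)) : W.geomPoints) = _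
    rw [e, map_neg, Pi.neg_apply, NegMemClass.coe_neg, map_neg, h τ i, Pi.neg_apply, smul_neg]
    abel
  have isW_sub : ∀ {ψ ψ' Q Q'}, IsW ψ Q → IsW ψ' Q' → IsW (ψ - ψ') (Q - Q') := fun {ψ ψ' Q Q'} h h' ↦ by
    rw [sub_eq_add_neg, sub_eq_add_neg]; exact isW_add h (isW_neg h')
  have isW_zero : IsW 0 0 := fun τ i ↦ by
    change pointsMapOfEmb W _ ((Θ (0 : Cofree ρ ↥(padicCoeffField S)) i : ↥(W.geomPrimaryTorsion 2)) : W.geomPoints) = _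
    rw [map_zero, Pi.zero_apply, ZeroMemClass.coe_zero, map_zero, Pi.zero_apply, smul_zero, sub_zero]
  -- (KILL) a class with a witness tuple in `N` is `0`, so `χ` kills it
  have hkill : ∀ (ψ : contOneCocycles (subgroupRep (localRepOf (cofreeGaloisModule S ρ) v) (kerGroup κ v)))
      (Q : Fin r → localPoints W (v.adicCompletion ℚ)), IsW ψ Q → Q ∈ N → χ (oneCocycleClass _ ψ) = 0 := by
    intro ψ Q hW hQN
    have hQN' := hmemN.1 hQN
    choose e he u hu heu using fun i ↦ AddSubgroup.mem_sup.1 (hQN' i)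
    choose t ht htu using fun i ↦ AddSubgroup.mem_map.1 (hu i)
    rw [oneCocycleClass_eq_zero_of_torsionWitness S ρ W Θ κ v hΘ ψ Q hW e he (fun i ↦ ⟨t i, ht i⟩)
      (fun i ↦ by rw [← heu i, ← htu i]), map_zero]
  -- the subgroup of witness tuples
  let Wit : AddSubgroup (Fin r → localPoints W (v.adicCompletion ℚ)) :=
    { carrier := {Q | ∃ (ψ : contOneCocycles (subgroupRep (localRepOf (cofreeGaloisModule S ρ) v) (kerGroup κ v))) (k : ℕ),
        (∀ i, (2 ^ k) • Q i ∈ T) ∧ IsW ψ Q}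
      zero_mem' := ⟨0, 0, fun i ↦ by rw [Pi.zero_apply, smul_zero]; exact zero_mem T, isW_zero⟩
      add_mem' := by
        rintro Q Q' ⟨ψ, k, hQ, hW⟩ ⟨ψ', k', hQ', hW'⟩
        refine ⟨ψ + ψ', k + k', fun i ↦ ?_, isW_add hW hW'⟩
        rw [Pi.add_apply, smul_add]
        refine add_mem ?_ ?_
        · rw [pow_add, mul_comm, mul_smul]; exact AddSubgroup.nsmul_mem T (hQ i) _
        · rw [pow_add, mul_smul]; exact AddSubgroup.nsmul_mem T (hQ' i) _
      neg_mem' := by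
        rintro Q ⟨ψ, k, hQ, hW⟩
        exact ⟨-ψ, k, fun i ↦ by rw [Pi.neg_apply, smul_neg]; exact neg_mem (hQ i), isW_neg hW⟩ }
  have hWit : ∀ Q : Wit, ∃ (ψ : contOneCocycles (subgroupRep (localRepOf (cofreeGaloisModule S ρ) v) (kerGroup κ v))) (k : ℕ),
      (∀ i, (2 ^ k) • (Q : Fin r → localPoints W (v.adicCompletion ℚ)) i ∈ T) ∧ IsW ψ Q := fun Q ↦ Q.2
  choose ψW kW hTW hWW using hWit
  -- two witnessed classes with witness tuples congruent mod `N` have the same `χ`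
  have hcongr : ∀ (ψ ψ' : contOneCocycles (subgroupRep (localRepOf (cofreeGaloisModule S ρ) v) (kerGroup κ v)))
      (Q Q' : Fin r → localPoints W (v.adicCompletion ℚ)), IsW ψ Q → IsW ψ' Q' → Q - Q' ∈ N →
      χ (oneCocycleClass _ ψ) = χ (oneCocycleClass _ ψ') := by
    intro ψ ψ' Q Q' hW hW' hQQ'
    rw [← sub_eq_zero, ← map_sub, ← oneCocycleClass_sub]
    exact hkill (ψ - ψ') (Q - Q') (isW_sub hW hW') hQQ'
  -- the descended character on `Wit`
  let Φ : Wit →+ AddCircle (1 : ℚ) :=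
    { toFun := fun Q ↦ χ (oneCocycleClass _ (ψW Q))
      map_zero' := hkill (ψW 0) _ (hWW 0) (by rw [ZeroMemClass.coe_zero]; exact zero_mem N)
      map_add' := fun Q Q' ↦ by
        change χ (oneCocycleClass _ (ψW (Q + Q'))) = χ (oneCocycleClass _ (ψW Q)) + χ (oneCocycleClass _ (ψW Q'))
        rw [← map_add, ← oneCocycleClass_add]
        exact hcongr (ψW (Q + Q')) (ψW Q + ψW Q') _ _ (hWW _) (isW_add (hWW Q) (hWW Q')) (by rw [AddSubgroup.coe_add, sub_self]; exact zero_mem N) }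
  have hΦ : ∀ Q : Wit, Φ Q = χ (oneCocycleClass _ (ψW Q)) := fun Q ↦ rfl
  have hΦN : ∀ Q : Wit, (Q : Fin r → localPoints W (v.adicCompletion ℚ)) ∈ N → Φ Q = 0 := fun Q hQN ↦
    hkill (ψW Q) Q (hWW Q) hQN
  -- extension to `Wit ⊔ N` (zero on `N`), then to all tuples
  let WitS : Submodule ℤ (Fin r → localPoints W (v.adicCompletion ℚ)) := Wit.toIntSubmodule
  let NS : Submodule ℤ (Fin r → localPoints W (v.adicCompletion ℚ)) := N.toIntSubmodule
  let f₁ : (Fin r → localPoints W (v.adicCompletion ℚ)) →ₗ.[ℤ] AddCircle (1 : ℚ) := ⟨WitS, Φ.toIntLinearMap⟩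
  let f₂ : (Fin r → localPoints W (v.adicCompletion ℚ)) →ₗ.[ℤ] AddCircle (1 : ℚ) := ⟨NS, 0⟩
  have Hagree : ∀ (x : f₁.domain) (y : f₂.domain), (x : Fin r → localPoints W (v.adicCompletion ℚ)) = y → f₁ x = f₂ y := by
    intro x y hxy
    change Φ x = (0 : NS →ₗ[ℤ] AddCircle (1 : ℚ)) y
    rw [LinearMap.zero_apply]
    exact hΦN x (by rw [hxy]; exact y.2)
  let f := f₁.sup f₂ Hagree
  obtain ⟨χt, hχt⟩ := CharacterModule.dual_surjective_of_injective (R := ℤ) f.domain.subtype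
    (Submodule.injective_subtype _) f.toFun.toAddMonoidHom
  have hχt_apply : ∀ x : f.domain, χt (x : Fin r → localPoints W (v.adicCompletion ℚ)) = f x := fun x ↦ DFunLike.congr_fun hχt x
  have hχt_Wit : ∀ Q : Wit, χt (Q : Fin r → localPoints W (v.adicCompletion ℚ)) = χ (oneCocycleClass _ (ψW Q)) := fun Q ↦ by
    have hle := f₁.left_le_sup f₂ Hagree
    have e1 : f₁ Q = f (Submodule.inclusion hle.1 Q) := LinearPMap.apply_comp_inclusion hle Q
    rw [← hΦ, show Φ Q = f₁ Q from rfl, e1, ← hχt_apply]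
    rfl
  have hχt_N : ∀ u : Fin r → localPoints W (v.adicCompletion ℚ), u ∈ N → χt u = 0 := fun u hu ↦ by
    have hle := f₁.right_le_sup f₂ Hagree
    have e1 : f₂ ⟨u, hu⟩ = f (Submodule.inclusion hle.1 ⟨u, hu⟩) := LinearPMap.apply_comp_inclusion hle ⟨u, hu⟩
    have e2 : f₂ ⟨u, hu⟩ = 0 := rfl
    rw [show χt u = χt ((Submodule.inclusion hle.1 ⟨u, hu⟩ : f.domain) : Fin r → localPoints W (v.adicCompletion ℚ)) from rfl, hχt_apply, ← e1, e2]
  -- roots of a tuple differ by `N`-elements, so `χt` is constant on the roots of a tuple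
  have hroot : ∀ {k : ℕ} {Q Q' P : Fin r → localPoints W (v.adicCompletion ℚ)},
      (∀ i, (2 ^ k) • Q i = P i) → (∀ i, (2 ^ k) • Q' i = P i) → χt Q' = χt Q := by
    intro k Q Q' P hQ hQ'
    have hd : Q' - Q ∈ N := by
      refine hmemN.2 fun i ↦ ?_
      obtain ⟨t, ht⟩ := exists_torsion_of_pow_nsmul_eq W 2 (closureEmb (K := ℚ) (v.adicCompletion ℚ)) (hQ i) (hQ' i)
      rw [Pi.sub_apply, ht, add_sub_cancel_left]
      exact AddSubgroup.mem_sup_right (AddSubgroup.mem_map_of_mem _ t.2)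
    have h := hχt_N _ hd
    rw [map_sub, sub_eq_zero] at h
    exact h
  -- chosen roots and the residues `Nk P : ℤ/2^k`
  have hdiv : ∀ (k : ℕ) (P : Fin r → localPoints W (v.adicCompletion ℚ)), ∃ Q : Fin r → localPoints W (v.adicCompletion ℚ), ∀ i, (2 ^ k) • Q i = P i :=
    fun k P ↦ by
      choose Q hQ using fun i ↦ W.nsmul_surjective_localPoints (v.adicCompletion ℚ) (pow_ne_zero k two_ne_zero) (P i)
      exact ⟨Q, hQ⟩
  choose R hR using hdiv
  have hval : ∀ (k : ℕ) (P : Fin r → ↥T), ∃ n : ZMod (2 ^ k),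
      χt (R k (fun i ↦ (P i : localPoints W (v.adicCompletion ℚ)))) = n.val • ((((2 : ℚ) ^ k)⁻¹ : ℚ) : AddCircle (1 : ℚ)) := fun k P ↦ by
    obtain ⟨n, hn⟩ := exists_zmod_val_smul_invPow_eq 2 k (χt (R k (fun i ↦ (P i : localPoints W (v.adicCompletion ℚ))))) (by
      rw [← map_nsmul]
      refine hχt_N _ (hmemN.2 fun i ↦ ?_)
      rw [Pi.smul_apply, hR k]
      exact AddSubgroup.mem_sup_left (P i).2)
    exact ⟨n, by rw [hn]; norm_cast⟩
  choose Nk hNk using hval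
  -- value of `χt` at ANY `2^k`-th root of a tower tuple
  have hNk' : ∀ (k : ℕ) (P : Fin r → ↥T) (Q : Fin r → localPoints W (v.adicCompletion ℚ)), (∀ i, (2 ^ k) • Q i = (P i : localPoints W (v.adicCompletion ℚ))) →
      χt Q = (Nk k P).val • ((((2 : ℚ) ^ k)⁻¹ : ℚ) : AddCircle (1 : ℚ)) := fun k P Q hQ ↦ by
    rw [hroot (hR k (fun i ↦ (P i : localPoints W (v.adicCompletion ℚ)))) hQ, hNk]
  have hx0 : ∀ k : ℕ, (2 ^ k) • ((((2 : ℚ) ^ k)⁻¹ : ℚ) : AddCircle (1 : ℚ)) = 0 := fun k ↦ by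
    have h := pow_nsmul_invPow_self 2 k
    norm_cast at h ⊢
  -- compatibility `Nk (k+1) P ≡ Nk k P (mod 2^k)`
  have hcompat : ∀ (P : Fin r → ↥T) (k : ℕ), ZMod.castHom (pow_dvd_pow 2 (Nat.le_succ k)) (ZMod (2 ^ k)) (Nk (k + 1) P) = Nk k P := by
    intro P k
    haveI : NeZero (2 ^ k) := ⟨pow_ne_zero k two_ne_zero⟩
    haveI : NeZero (2 ^ (k + 1)) := ⟨pow_ne_zero (k + 1) two_ne_zero⟩
    have hfaith := @zmod_eq_of_val_smul_invPow_eq 2 _ k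
    have hroot' : ∀ i, (2 ^ k) • ((2 : ℕ) • R (k + 1) (fun i ↦ (P i : localPoints W (v.adicCompletion ℚ))) i) = (P i : localPoints W (v.adicCompletion ℚ)) :=
      fun i ↦ by rw [smul_smul, ← pow_succ, hR]
    have h1 := hNk' k P _ hroot'
    rw [show (fun i ↦ (2 : ℕ) • R (k + 1) (fun i ↦ (P i : localPoints W (v.adicCompletion ℚ))) i) =
        (2 : ℕ) • R (k + 1) (fun i ↦ (P i : localPoints W (v.adicCompletion ℚ))) from rfl, map_nsmul, hNk (k + 1) P, smul_smul] at h1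
    have h2 : (2 * (Nk (k + 1) P).val) • ((((2 : ℚ) ^ (k + 1))⁻¹ : ℚ) : AddCircle (1 : ℚ)) =
        (Nk (k + 1) P).val • ((((2 : ℚ) ^ k)⁻¹ : ℚ) : AddCircle (1 : ℚ)) := by
      have e := pow_nsmul_invPow_eq 2 (Nat.le_succ k)
      rw [Nat.succ_sub (le_refl k), Nat.sub_self, pow_one] at e
      push_cast at e
      rw [mul_comm, mul_smul, e]
    rw [h2] at h1
    apply hfaith
    push_cast
    rw [ZMod.castHom_apply, ZMod.cast_eq_val, ZMod.val_natCast, IwasawaDual.mod_smul_eq (hx0 k), ← h1]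
  -- the functional
  have hz : ∀ P : Fin r → ↥T, ∃ x : ℤ_[2], ∀ k, PadicInt.toZModPow k x = Nk k P := fun P ↦
    exists_padicInt_toZModPow_eq 2 (fun k ↦ Nk k P) (hcompat P)
  choose zf hzf using hz
  have hzf_add : ∀ P P' : Fin r → ↥T, zf (P + P') = zf P + zf P' := by
    intro P P'
    refine PadicInt.ext_of_toZModPow.1 fun k ↦ ?_
    haveI : NeZero (2 ^ k) := ⟨pow_ne_zero k two_ne_zero⟩
    rw [map_add, hzf, hzf, hzf]
    apply @zmod_eq_of_val_smul_invPow_eq 2 _ k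
    push_cast
    have hsum : ∀ i, (2 ^ k) • (R k (fun i ↦ (P i : localPoints W (v.adicCompletion ℚ))) i + R k (fun i ↦ (P' i : localPoints W (v.adicCompletion ℚ))) i) =
        ((P + P') i : localPoints W (v.adicCompletion ℚ)) := fun i ↦ by
      rw [smul_add, hR, hR, Pi.add_apply, AddSubgroup.coe_add]
    have h := hNk' k (P + P') (fun i ↦ R k (fun i ↦ (P i : localPoints W (v.adicCompletion ℚ))) i + R k (fun i ↦ (P' i : localPoints W (v.adicCompletion ℚ))) i) hsum
    rw [show (fun i ↦ R k (fun i ↦ (P i : localPoints W (v.adicCompletion ℚ))) i + R k (fun i ↦ (P' i : localPoints W (v.adicCompletion ℚ))) i) =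
        R k (fun i ↦ (P i : localPoints W (v.adicCompletion ℚ))) + R k (fun i ↦ (P' i : localPoints W (v.adicCompletion ℚ))) from rfl,
      map_add, hNk, hNk] at h
    rw [← h, ZMod.val_add, IwasawaDual.mod_smul_eq (hx0 k), add_smul]
  refine ⟨{ toFun := zf, map_zero' := ?_, map_add' := hzf_add }, fun y ψ Q k hQ hψ hW ↦ ?_⟩
  · have h := hzf_add 0 0
    rwa [add_zero, left_eq_add] at h
  · -- the value formula
    change χ y = (PadicInt.toZModPow k (zf (fun i ↦ ⟨(2 ^ k) • Q i, hQ i⟩))).val • _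
    rw [hzf, ← hNk' k (fun i ↦ ⟨(2 ^ k) • Q i, hQ i⟩) Q (fun i ↦ rfl)]
    have hQW : Q ∈ Wit := ⟨ψ, k, hQ, hW⟩
    rw [show χt Q = χt ((⟨Q, hQW⟩ : Wit) : Fin r → localPoints W (v.adicCompletion ℚ)) from rfl, hχt_Wit ⟨Q, hQW⟩, ← hψ]
    exact hcongr ψ (ψW ⟨Q, hQW⟩) Q Q hW (hWW ⟨Q, hQW⟩) (by rw [sub_self]; exact zero_mem N)

/-! ## §3 (PERF₂): a value-pinned `c₂` is surjective -/

include hΘ in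
/-- **(PERF₂)** On the habitat (`GoodSS W 2`, `κ` cyclotomic, `v ∋ 2`) any additive `c₂ : 𝔉₂ →+ CharacterModule D₂` carrying the VALUE PIN `AtTwoPins.hc₂` is
SURJECTIVE: given `χ`, §2 gives `t` with the same values on every datum, and every class has a datum (part 1 `exists_localKummerData`).
[cite: Kobayashi2003, (8.23) (p. 18)] [cite: GreenbergLNM1716, §2] -/
theorem surjective_of_valuePin [W.IsGloballyMinimal] (hGood : Rank1Residual.GoodSS W 2) (hκ : κ.IsCyclotomic) (hv : ((2 : ℕ) : 𝓞 ℚ) ∈ v.asIdeal)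
    (c₂ : ((Fin r → ↥(localTowerPointsOfEmb κ (closureEmb (K := ℚ) (v.adicCompletion ℚ)) W)) →+ ℤ_[2]) →+ CharacterModule (Dloc S κ ρ v))
    (hc₂ : ∀ (t : (Fin r → ↥(localTowerPointsOfEmb κ (closureEmb (K := ℚ) (v.adicCompletion ℚ)) W)) →+ ℤ_[2])
      (y : Dloc S κ ρ v) (ψ : contOneCocycles (subgroupRep (localRepOf (cofreeGaloisModule S ρ) v) (kerGroup κ v)))
      (Q : Fin r → localPoints W (v.adicCompletion ℚ)) (k : ℕ)
      (hQ : ∀ i, (2 ^ k) • Q i ∈ localTowerPointsOfEmb κ (closureEmb (K := ℚ) (v.adicCompletion ℚ)) W),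
      oneCocycleClass (subgroupRep (localRepOf (cofreeGaloisModule S ρ) v) (kerGroup κ v)) ψ = y →
      (∀ (τ : ↥(kerGroup κ v)) (i : Fin r), pointsMapOfEmb W (closureEmb (K := ℚ) (v.adicCompletion ℚ))
        ((Θ (ψ.1 τ) i : ↥(W.geomPrimaryTorsion 2)) : W.geomPoints) = (τ : absoluteGaloisGroup (v.adicCompletion ℚ)) • Q i - Q i) →
      c₂ t y = (PadicInt.toZModPow k (t (fun i => ⟨(2 ^ k) • Q i, hQ i⟩))).val • ((((2 : ℚ) ^ k)⁻¹ : ℚ) : AddCircle (1 : ℚ))) :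
    Function.Surjective c₂ := by
  intro χ
  obtain ⟨t, ht⟩ := exists_functional_of_character S ρ W Θ κ v hΘ χ
  refine ⟨t, DFunLike.ext _ _ fun y ↦ ?_⟩
  obtain ⟨ψ, Q, k, hψ, hQ, hK⟩ := exists_localKummerData S ρ W Θ κ v hΘ hGood hκ hv y
  rw [hc₂ t y ψ Q k hQ hψ hK, ht y ψ Q k hQ hψ hK]

end Summit.BirchSwinnertonDyer.BirchSwinnertonDyer.Theorems.ThetaTransport.AtTwoPackage

end
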